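import Summits.ValiantsHypothesis.ValiantsHypothesis.Theorems.LacunarySymmetroidMatrixDescartesCensusChamberTableB

/-!
# `MatrixDescartes` census — `stub_chamberCover` of the crux line `census` (DoorA26), part 0: the three generic lemmas of the comparison tree

HONEST FRAMING.  Object-search cell `pub-symmetroid`; crux `DoorA26 = PosRootLawAt 2 6 19` (stmt-ValiantsHypothesis-19979; OPEN, typed, never asserted);
registered line `Cruxes/DoorA26/Lines/census.lean`, stub `stub_chamberCover` = COMPLETENESS OF THE 2 608-CHAMBER TABLE `Census.chamber`
(`…CensusChamberTableA/B`): every sorted generic support `0 = d₀ < ⋯ < d₅` (generic = a covering order along which the 21 pair sums increase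
strictly) lies in a LISTED chamber.  The proof (val-sym-door-p5 g6) is a table-guided COMPARISON TREE: the 21 pair sums of a generic support are
pairwise distinct (`pairSum_ne_of_cover`), so any two compare strictly (`split`); branching on at most 15 of the 35 sortedness-free comparisons
`d_a + d_e ≶ d_b + d_c` / `2d_i ≶ d_k + d_l` singles out one listed order, whose twenty adjacent comparisons are then available (decided on the
path, implied by sortedness, or implied by the decided ones — then by `linarith only [...]` on the support of an exact Farkas
certificate computed by the generator) and `leaf` concludes.  The tree (2 608 leaves, 2 607
branchings, depth ≤ 15) is split into subtree theorems `ChamberCover.node_*` in the files `…CensusChamberCoverPart*`; the assembly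
`Census.chamberCover` (VERBATIM the body of `Stmt.stub_chamberCover`) is `…CensusChamberCover`.  Finite combinatorics only: nothing here kills a
chamber or bounds a `ζ`; registers unchanged; nothing on `MatrixDescartes` (stmt-ValiantsHypothesis-18050) or `VP ≠ VNP`.

[folklore] Elementary.
-/

-- `Summit.ValiantsHypothesis.ValiantsHypothesis.…` repeats a component by the D-0017 layout
-- (single-conjunct summit), which the `dupNamespace` linter flags; the name is mandated.
set_option linter.dupNamespace false

namespace Summit.ValiantsHypothesis.ValiantsHypothesis.Theorems.LacunarySymmetroidMatrixDescartes.Census.ChamberCover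

/-- The 21 canonical pair sums of a sorted GENERIC support are pairwise distinct: genericity is given, as in the crux line, by a
covering order `σ` along which the pair sums are strictly increasing. [folklore] -/
theorem pairSum_ne_of_cover (x : Fin 6 → ℕ) (σ : Fin 21 → Fin 6 × Fin 6)
    (hcov : ∀ p : Fin 6 × Fin 6, ∃ t : Fin 21, σ t = p ∨ σ t = p.swap)
    (hmono : StrictMono ((fun p : Fin 6 × Fin 6 => x p.1 + x p.2) ∘ σ)) :
    ∀ p q : Fin 6 × Fin 6, p ≠ q → p ≠ q.swap → x p.1 + x p.2 ≠ x q.1 + x q.2 := by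
  intro p q hpq hpq'
  obtain ⟨t, ht⟩ := hcov p
  obtain ⟨t', ht'⟩ := hcov q
  have hsum : ∀ (r : Fin 6 × Fin 6) (u : Fin 21), (σ u = r ∨ σ u = r.swap) →
      ((fun p : Fin 6 × Fin 6 => x p.1 + x p.2) ∘ σ) u = x r.1 + x r.2 := by
    intro r u hu
    rcases hu with hu | hu
    · simp [Function.comp, hu]
    · simp [Function.comp, hu, Prod.swap, Nat.add_comm]
  have htt : t ≠ t' := by
    rintro rfl
    rcases ht with ht | ht <;> rcases ht' with ht' | ht'
    · exact hpq (ht.symm.trans ht')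
    · exact hpq' (ht.symm.trans ht')
    · exact hpq' (by rw [← Prod.swap_swap p, ← ht, ht'])
    · exact hpq (Prod.swap_injective (ht.symm.trans ht'))
  intro heq
  apply htt
  apply hmono.injective
  rw [hsum p t ht, hsum q t' ht', heq]

/-- Branching step of the comparison tree: two different pair sums compare strictly one way or the other. [folklore] -/
theorem split {x : Fin 6 → ℕ}
    (hne : ∀ p q : Fin 6 × Fin 6, p ≠ q → p ≠ q.swap → x p.1 + x p.2 ≠ x q.1 + x q.2)
    (a b c e : Fin 6) (h1 : (a, b) ≠ (c, e)) (h2 : (a, b) ≠ (e, c)) :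
    x a + x b < x c + x e ∨ x c + x e < x a + x b :=
  lt_or_gt_of_ne (hne (a, b) (c, e) h1 h2)

/-- Leaf step of the comparison tree: the twenty adjacent comparisons of a listed order `τ = chamber n` put the support in chamber `n`.
[folklore] -/
theorem leaf {x : Fin 6 → ℕ} (n : ℕ) (hn : n < 2608) (τ : Fin 21 → Fin 6 × Fin 6) (hc : chamber n = τ)
    (h0 : x (τ 0).1 + x (τ 0).2 < x (τ 1).1 + x (τ 1).2) (h1 : x (τ 1).1 + x (τ 1).2 < x (τ 2).1 + x (τ 2).2)
    (h2 : x (τ 2).1 + x (τ 2).2 < x (τ 3).1 + x (τ 3).2) (h3 : x (τ 3).1 + x (τ 3).2 < x (τ 4).1 + x (τ 4).2)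
    (h4 : x (τ 4).1 + x (τ 4).2 < x (τ 5).1 + x (τ 5).2) (h5 : x (τ 5).1 + x (τ 5).2 < x (τ 6).1 + x (τ 6).2)
    (h6 : x (τ 6).1 + x (τ 6).2 < x (τ 7).1 + x (τ 7).2) (h7 : x (τ 7).1 + x (τ 7).2 < x (τ 8).1 + x (τ 8).2)
    (h8 : x (τ 8).1 + x (τ 8).2 < x (τ 9).1 + x (τ 9).2) (h9 : x (τ 9).1 + x (τ 9).2 < x (τ 10).1 + x (τ 10).2)
    (h10 : x (τ 10).1 + x (τ 10).2 < x (τ 11).1 + x (τ 11).2) (h11 : x (τ 11).1 + x (τ 11).2 < x (τ 12).1 + x (τ 12).2)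
    (h12 : x (τ 12).1 + x (τ 12).2 < x (τ 13).1 + x (τ 13).2) (h13 : x (τ 13).1 + x (τ 13).2 < x (τ 14).1 + x (τ 14).2)
    (h14 : x (τ 14).1 + x (τ 14).2 < x (τ 15).1 + x (τ 15).2) (h15 : x (τ 15).1 + x (τ 15).2 < x (τ 16).1 + x (τ 16).2)
    (h16 : x (τ 16).1 + x (τ 16).2 < x (τ 17).1 + x (τ 17).2) (h17 : x (τ 17).1 + x (τ 17).2 < x (τ 18).1 + x (τ 18).2)
    (h18 : x (τ 18).1 + x (τ 18).2 < x (τ 19).1 + x (τ 19).2) (h19 : x (τ 19).1 + x (τ 19).2 < x (τ 20).1 + x (τ 20).2) :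
    ∃ n < 2608, StrictMono ((fun p : Fin 6 × Fin 6 => x p.1 + x p.2) ∘ chamber n) := by
  refine ⟨n, hn, ?_⟩
  rw [hc, Fin.strictMono_iff_lt_succ]
  intro i
  fin_cases i
  exacts [h0, h1, h2, h3, h4, h5, h6, h7, h8, h9, h10, h11, h12, h13, h14, h15, h16, h17, h18, h19]

end Summit.ValiantsHypothesis.ValiantsHypothesis.Theorems.LacunarySymmetroidMatrixDescartes.Census.ChamberCover
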